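import Literature.AlgebraicTopology.Homotopy.CubePairMaps
import HarnessLib

/-!
# Sliding a side face of a cube into the adjacent lid

Topic `Literature/AlgebraicTopology/Homotopy`, continuing `CubePairMaps.lean` and
`SquareUnfold.lean`. For a singular cube `g : Iᴹ⁺³ → X` constant `= x` on the codimension-two
skeleton (`CubeHAT.IsSkelConst`) and an index `i : Fin (M + 2)`, the **move**
`move g i θ = g ∘ pairMap p q θ` in the adjacent coordinates `p = i.castSucc`, `q = i.succ` by the
unfolding `θ = unfold 1` (resp. `unfold' 1`) of `SquareUnfold.lean` has the following faces
(Hatcher, *Algebraic Topology* (2002), §4.1, pp. 340–341: the deformations of `Iⁿ` behind the sum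
in `πₙ`):

* it is again constant on the codimension-two skeleton (`IsSkelConst.move`);
* the face `{y_q = 1}` (resp. `{y_q = 0}`) becomes constant (`move_insertNth_succ_of_collapse`);
  the faces `{y_q = 0}` (resp. `{y_q = 1}`) and `{y_p = 0}` are unchanged pointwise
  (`move_insertNth_succ_of_fixed`, `move_insertNth_castSucc_zero_of_fixed`);
* the lid `{y_p = 1}` becomes the concatenation, along the coordinate `i`, of the old lid with the
  reversed side `{y_q = 1}` (resp. of the side `{y_q = 0}` with the old lid), literally Mathlib's
  `GenLoop.transAt i`/`GenLoop.symmAt i` (`faceLoop_move_unfold_castSucc_one`,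
  `faceLoop_move_unfold'_castSucc_one`);
* every other face keeps its class (`CubePairMaps.faceClass_precomp_pairMap`).

Everything is elementary and proved; `[folklore]`.

## References

* A. Hatcher, *Algebraic Topology*, CUP (2002), §4.1, pp. 340–341. [HatcherAT2002]
-/

noncomputable section

open scoped unitInterval Topology Topology.Homotopy
open Set Function

universe u

namespace Literature.AlgebraicTopology.Homotopy

namespace CubeHAT

open SquareUnfold

variable {N M : ℕ} {X : Type u} [TopologicalSpace X] {x : X}

/-! ### Corners of the square; the unfoldings preserve corners -/

/-- The four corners of the square. [folklore] -/
def sqCorner : Set (I × I) := {p | IsExtreme p.1 ∧ IsExtreme p.2}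

/-- The boundary of the square in terms of `IsExtreme`. [folklore] -/
lemma mem_sqBoundary_iff_isExtreme (p : I × I) : p ∈ sqBoundary ↔ IsExtreme p.1 ∨ IsExtreme p.2 := by
  simp only [mem_sqBoundary_iff, IsExtreme, or_assoc]

/-- `unfold 1` maps corners to corners. [folklore] -/
lemma unfold_one_mapsTo_sqCorner : MapsTo (unfold 1) sqCorner sqCorner := by
  rintro ⟨s, u⟩ ⟨hs | hs, hu | hu⟩ <;> simp only at hs hu <;> subst hs <;> subst hu
  · rw [unfold_zero_left]; exact ⟨isExtreme_zero, isExtreme_zero⟩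
  · rw [unfold_zero_left]; exact ⟨isExtreme_zero, isExtreme_one⟩
  · rw [unfold_zero_right]; exact ⟨isExtreme_one, isExtreme_zero⟩
  · rw [unfold_one_one_one]; exact ⟨isExtreme_zero, isExtreme_one⟩

/-- `unfold' 1` maps corners to corners. [folklore] -/
lemma unfold'_one_mapsTo_sqCorner : MapsTo (unfold' 1) sqCorner sqCorner := by
  rintro ⟨s, u⟩ ⟨hs | hs, hu | hu⟩ <;> simp only at hs hu <;> subst hs <;> subst hu
  · rw [unfold'_zero_left]; exact ⟨isExtreme_zero, isExtreme_zero⟩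
  · rw [unfold'_zero_left]; exact ⟨isExtreme_zero, isExtreme_one⟩
  · rw [unfold'_one_one_zero]; exact ⟨isExtreme_zero, isExtreme_zero⟩
  · rw [unfold'_one_right]; exact ⟨isExtreme_one, isExtreme_one⟩

/-- `unfold t` maps the boundary of the square into itself (as `MapsTo`). [folklore] -/
lemma unfold_mapsTo_sqBoundary (l : I) : MapsTo (unfold l) sqBoundary sqBoundary :=
  fun _ hp => unfold_mem_sqBoundary l hp

/-- `unfold' t` maps the boundary of the square into itself (as `MapsTo`). [folklore] -/
lemma unfold'_mapsTo_sqBoundary (l : I) : MapsTo (unfold' l) sqBoundary sqBoundary :=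
  fun _ hp => unfold'_mem_sqBoundary l hp

/-! ### Pair moves preserve constancy on the codimension-two skeleton -/

/-- **A pair move by a boundary- and corner-preserving `θ` keeps a cube constant on the
codimension-two skeleton.** [folklore] -/
theorem IsSkelConst.precomp_pairMap {g : C(Fin (N + 1) → I, X)} (hg : IsSkelConst x g)
    {a b : Fin (N + 1)} (hab : a ≠ b) {θ : I × I → I × I} (hθ : Continuous θ)
    (hθb : MapsTo θ sqBoundary sqBoundary) (hθc : MapsTo θ sqCorner sqCorner) :
    IsSkelConst x (precomp g (pairMap a b θ) (continuous_pairMap hθ)) := by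
  intro y i j hij hi hj
  rw [precomp_apply]
  -- an extreme coordinate off `{a, b}` survives the move
  have hoff : ∀ k, k ≠ a → k ≠ b → IsExtreme (y k) → IsExtreme (pairMap a b θ y k) :=
    fun k hka hkb hk => by rwa [pairMap_apply_of_ne hka hkb]
  -- an extreme coordinate in `{a, b}` yields an extreme coordinate in `{a, b}` after the move
  have hon : ∀ k, (k = a ∨ k = b) → IsExtreme (y k) →
      IsExtreme (pairMap a b θ y a) ∨ IsExtreme (pairMap a b θ y b) := by
    rintro k hk hke
    have hm : θ (y a, y b) ∈ sqBoundary := by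
      apply hθb
      rw [mem_sqBoundary_iff_isExtreme]
      rcases hk with rfl | rfl
      · exact Or.inl hke
      · exact Or.inr hke
    rw [mem_sqBoundary_iff_isExtreme] at hm
    rwa [pairMap_apply_fst hab, pairMap_apply_snd]
  by_cases hia : i = a ∨ i = b
  · by_cases hja : j = a ∨ j = b
    · -- both in `{a, b}`: a corner
      have hya : IsExtreme (y a) := by
        rcases hia with rfl | rfl
        · exact hi
        · rcases hja with rfl | rfl
          · exact hj
          · exact absurd rfl hij
      have hyb : IsExtreme (y b) := by
        rcases hia with rfl | rfl
        · rcases hja with rfl | rfl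
          · exact absurd rfl hij
          · exact hj
        · exact hi
      have hc : θ (y a, y b) ∈ sqCorner := hθc ⟨hya, hyb⟩
      refine hg _ a b hab ?_ ?_
      · rw [pairMap_apply_fst hab]; exact hc.1
      · rw [pairMap_apply_snd]; exact hc.2
    · push Not at hja
      rcases hon i hia hi with h | h
      · exact hg _ a j hja.1.symm h (hoff j hja.1 hja.2 hj)
      · exact hg _ b j hja.2.symm h (hoff j hja.1 hja.2 hj)
  · push Not at hia
    by_cases hja : j = a ∨ j = b
    · rcases hon j hja hj with h | h
      · exact hg _ i a hia.1 (hoff i hia.1 hia.2 hi) h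
      · exact hg _ i b hia.2 (hoff i hia.1 hia.2 hi) h
    · push Not at hja
      exact hg _ i j hij (hoff i hia.1 hia.2 hi) (hoff j hja.1 hja.2 hj)

/-! ### Updating faces (over Mathlib's `Fin.update_insertNth`, `Fin.insertNth_update`) -/

/-- Away from `i`, the cofaces at `i.castSucc` and `i.succ` agree. [folklore] -/
lemma succAbove_castSucc_eq_succAbove_succ {i c : Fin (N + 1)} (h : c ≠ i) :
    i.castSucc.succAbove c = i.succ.succAbove c := by
  rcases lt_or_gt_of_ne h with hlt | hgt
  · rw [Fin.succAbove_of_castSucc_lt _ _ (Fin.castSucc_lt_castSucc_iff.2 hlt),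
      Fin.succAbove_of_castSucc_lt _ _ ((Fin.castSucc_lt_castSucc_iff.2 hlt).trans
        (Fin.castSucc_lt_succ : i.castSucc < i.succ))]
  · rw [Fin.succAbove_of_le_castSucc _ _ (Fin.castSucc_le_castSucc_iff.2 hgt.le),
      Fin.succAbove_of_le_castSucc _ _ (Fin.succ_le_castSucc_iff.2 hgt)]

/-- `i.castSucc ≠ i.succ`. [folklore] -/
lemma castSucc_ne_succ (i : Fin (N + 1)) : i.castSucc ≠ i.succ :=
  (Fin.castSucc_lt_succ : i.castSucc < i.succ).ne

/-- The point of the lid `{y_p = 1}` (`p = i.castSucc`) above `t`, moved in the pair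
`(p, i.succ)` to `(1, w)`: it is the lid point above `update t i w`. [folklore] -/
lemma update_update_insertNth_castSucc (i : Fin (N + 1)) (t : Fin (N + 1) → I) (w : I) :
    update (update (Fin.insertNth (α := fun _ => I) i.castSucc 1 t) i.castSucc 1) i.succ w =
      Fin.insertNth (α := fun _ => I) i.castSucc 1 (update t i w) := by
  have h1 : update (Fin.insertNth (α := fun _ => I) i.castSucc 1 t) i.castSucc 1 =
      Fin.insertNth (α := fun _ => I) i.castSucc 1 t :=
    update_eq_self_iff.2 (Fin.insertNth_apply_same (α := fun _ => I) _ _ _).symm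
  rw [h1, ← Fin.succAbove_castSucc_self i, ← Fin.insertNth_update]

/-- The point of the lid `{y_p = 1}` above `t`, moved in the pair `(p, q)` (`q = i.succ`) to
`(v, ε)`: it is the point of the side `{y_q = ε}` above `update t i v`. [folklore] -/
lemma update_update_insertNth_succ (i : Fin (N + 1)) (t : Fin (N + 1) → I) (v ε : I) :
    update (update (Fin.insertNth (α := fun _ => I) i.castSucc 1 t) i.castSucc v) i.succ ε =
      Fin.insertNth (α := fun _ => I) i.succ ε (update t i v) := by
  rw [Fin.eq_insertNth_iff]
  refine ⟨update_self _ _ _, ?_⟩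
  funext c
  rw [Fin.removeNth_apply]
  by_cases hc : c = i
  · subst hc
    rw [Fin.succAbove_succ_self, update_of_ne (castSucc_ne_succ c), update_self, update_self]
  · have h1 : i.succ.succAbove c ≠ i.succ := Fin.succAbove_ne _ _
    have h2 : i.succ.succAbove c ≠ i.castSucc := by
      rw [← Fin.succAbove_succ_self i]
      exact fun h => hc (Fin.succAbove_right_injective h)
    rw [update_of_ne h1, update_of_ne h2, ← succAbove_castSucc_eq_succAbove_succ hc,
      Fin.insertNth_apply_succAbove, update_of_ne hc]

/-! ### The move and its faces -/

/-- **The move of a cube `g : Iᴹ⁺² → X` in the adjacent coordinates `(i.castSucc, i.succ)` by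
`θ`.** [folklore] -/
def move (g : C(Fin (N + 2) → I, X)) (i : Fin (N + 1)) (θ : I × I → I × I) (hθ : Continuous θ) :
    C(Fin (N + 2) → I, X) :=
  precomp g (pairMap i.castSucc i.succ θ) (continuous_pairMap hθ)

/-- `move` pointwise. [folklore] -/
@[simp] lemma move_apply (g : C(Fin (N + 2) → I, X)) (i : Fin (N + 1)) (θ : I × I → I × I)
    (hθ : Continuous θ) (y : Fin (N + 2) → I) : move g i θ hθ y = g (pairMap i.castSucc i.succ θ y) :=
  rfl

/-- A move by `unfold 1` or `unfold' 1` keeps the cube constant on the codimension-two skeleton.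
[folklore] -/
lemma IsSkelConst.move {g : C(Fin (N + 2) → I, X)} (hg : IsSkelConst x g) (i : Fin (N + 1))
    {θ : I × I → I × I} (hθ : Continuous θ) (hθb : MapsTo θ sqBoundary sqBoundary)
    (hθc : MapsTo θ sqCorner sqCorner) : IsSkelConst x (move g i θ hθ) :=
  hg.precomp_pairMap (castSucc_ne_succ i) hθ hθb hθc

section Faces

variable {g : C(Fin (N + 2) → I, X)} (i : Fin (N + 1)) {θ : I × I → I × I} (hθ : Continuous θ)

/-- A face `{y_q = ε}` (`q = i.succ`) on whose edge `θ` is the identity is unchanged by the move.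
[folklore] -/
lemma move_insertNth_succ_of_fixed (ε : I) (hfix : ∀ s : I, θ (s, ε) = (s, ε))
    (t : Fin (N + 1) → I) :
    move g i θ hθ (Fin.insertNth i.succ ε t) = g (Fin.insertNth i.succ ε t) := by
  rw [move_apply, pairMap_eq_self_of]
  rw [Fin.insertNth_apply_same, hfix]

/-- The face `{y_p = 0}` (`p = i.castSucc`) is unchanged by a move fixing the edge `{s = 0}`.
[folklore] -/
lemma move_insertNth_castSucc_zero_of_fixed (hfix : ∀ u : I, θ (0, u) = (0, u))
    (t : Fin (N + 1) → I) :
    move g i θ hθ (Fin.insertNth i.castSucc 0 t) = g (Fin.insertNth i.castSucc 0 t) := by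
  rw [move_apply, pairMap_eq_self_of]
  rw [Fin.insertNth_apply_same, hfix]

/-- A face `{y_q = ε}` (`q = i.succ`) whose edge `θ` collapses to the corner `(0, ε)` becomes
constant `= x` after the move. [folklore] -/
lemma move_insertNth_succ_of_collapse (hg : IsSkelConst x g) {ε : I} (hε : IsExtreme ε)
    (hcol : ∀ s : I, θ (s, ε) = (0, ε)) (t : Fin (N + 1) → I) :
    move g i θ hθ (Fin.insertNth i.succ ε t) = x := by
  rw [move_apply]
  refine hg _ i.castSucc i.succ (castSucc_ne_succ i) ?_ ?_
  · rw [pairMap_apply_fst (castSucc_ne_succ i), Fin.insertNth_apply_same, hcol]; exact isExtreme_zero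
  · rw [pairMap_apply_snd, Fin.insertNth_apply_same, hcol]; exact hε

end Faces

/-- Mathlib's `GenLoop.transAt` pointwise. [folklore] -/
lemma transAt_apply (i : Fin N) (f h : Ω^ (Fin N) X x) (t : Fin N → I) :
    GenLoop.transAt i f h t =
      if (t i : ℝ) ≤ 1 / 2 then f (update t i (Set.projIcc 0 1 zero_le_one (2 * t i)))
      else h (update t i (Set.projIcc 0 1 zero_le_one (2 * t i - 1))) := rfl

/-- Mathlib's `GenLoop.symmAt` pointwise, through `Function.update`. [folklore] -/
lemma symmAt_apply_update (i : Fin N) (f : Ω^ (Fin N) X x) (t : Fin N → I) (v : I) :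
    GenLoop.symmAt i f (update t i v) = f (update t i (σ v)) := by
  change f _ = f _
  congr 1
  funext j
  by_cases hj : j = i
  · subst hj; simp
  · simp [hj]

variable {g : C(Fin (M + 3) → I, X)} (hg : IsSkelConst x g) (i : Fin (M + 2))

/-- **The lid after the move by `unfold 1`**: the face `{y_p = 1}` of `move g i (unfold 1)` is the
concatenation `transAt i` of the old lid with the reversed (`symmAt i`) side `{y_q = 1}`.
[folklore] -/
theorem faceLoop_move_unfold_castSucc_one
    (hg' : IsSkelConst x (move g i (unfold 1) (continuous_unfold_right 1))) :
    faceLoop _ hg' i.castSucc 1 isExtreme_one =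
      GenLoop.transAt i (faceLoop g hg i.castSucc 1 isExtreme_one)
        (GenLoop.symmAt i (faceLoop g hg i.succ 1 isExtreme_one)) := by
  refine genLoop_eq_of_forall fun t => ?_
  have hq : Fin.insertNth (α := fun _ => I) i.castSucc 1 t i.succ = t i := by
    rw [← Fin.succAbove_castSucc_self, Fin.insertNth_apply_succAbove]
  rw [faceLoop_apply, move_apply, transAt_apply, pairMap]
  simp only [Fin.insertNth_apply_same, hq]
  split_ifs with h
  · rw [unfold_one_left_of_le _ h, faceLoop_apply]
    exact congrArg g (update_update_insertNth_castSucc i t _)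
  · rw [unfold_one_left_of_ge _ (le_of_not_ge h), symmAt_apply_update, faceLoop_apply]
    exact congrArg g (update_update_insertNth_succ i t _ 1)

/-- **The lid after the move by `unfold' 1`**: the face `{y_p = 1}` of `move g i (unfold' 1)` is
the concatenation `transAt i` of the side `{y_q = 0}` with the old lid. [folklore] -/
theorem faceLoop_move_unfold'_castSucc_one
    (hg' : IsSkelConst x (move g i (unfold' 1) (continuous_unfold'_right 1))) :
    faceLoop _ hg' i.castSucc 1 isExtreme_one =
      GenLoop.transAt i (faceLoop g hg i.succ 0 isExtreme_zero)
        (faceLoop g hg i.castSucc 1 isExtreme_one) := by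
  refine genLoop_eq_of_forall fun t => ?_
  have hq : Fin.insertNth (α := fun _ => I) i.castSucc 1 t i.succ = t i := by
    rw [← Fin.succAbove_castSucc_self, Fin.insertNth_apply_succAbove]
  rw [faceLoop_apply, move_apply, transAt_apply, pairMap]
  simp only [Fin.insertNth_apply_same, hq]
  split_ifs with h
  · rw [unfold'_one_left_of_le _ h, faceLoop_apply]
    exact congrArg g (update_update_insertNth_succ i t _ 0)
  · rw [unfold'_one_left_of_ge _ (le_of_not_ge h), faceLoop_apply]
    exact congrArg g (update_update_insertNth_castSucc i t _)

end CubeHAT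

end Literature.AlgebraicTopology.Homotopy

end
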